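import Mathlib
import HarnessLib

/-!
# The `𝔪²`-test at a junction of a lifted companion configuration (card 7 `junction-unscrewing`, step (a))

[OURS · L1 ★L-G4 W4.5 (b)] Helper for the crux `EquisingularLiftNat` (stmt-ResolutionOfSingularities-20038; route
`EquisingularLift`, chain w45b), level 0 of CRUX-PLAN v3 §1.6 (companion centres). Proves VERBATIM the sorried statement
`JunctionSqMemIff` of res-L1-w45b-idea-2's `Sketch-L1-idea-2.lean` v5 (sha16 2c10f18d963ef2f6; card
`idea-junction-unscrewing.md` sha16 c7b4091fabff3d62, ROUND 4; ASK ×3 (B) 2026-08-27T06:26:09Z), so that the card's hinge is citable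
by name. NOT a statement of the manuscript under review (cell `res-hironaka`); AI-written kernel lemma, weaker than expert review.

**The situation (informal).** An `O`-flat lift of an in-`Y` single-sheet nodal companion configuration has, at a junction, the germ
`x y − ϖ·B` inside an `O`-smooth surface germ with parameters `(ϖ, x, y)`; the companion centre is REGULAR at the junction iff this
lifted node is NOT in `𝔪²`, i.e. iff `B` is a unit there. In the polynomial dress of the Sketch: in `O[X₀, X₁]` (`O` a domain,
`ϖ ≠ 0`), with `𝔪 = (ϖ, X₀, X₁)`, `X₀X₁ − ϖ·B ∈ 𝔪²` iff `B ∈ 𝔪`.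

* `constantCoeff_mem_span_pow_of_mem_pow` — constant coefficients of elements of `𝔪ⁿ` lie in `(ϖⁿ)`;
* `sub_C_constantCoeff_mem_span_X` — `B − B(0) ∈ (X₀, X₁)`;
* `JunctionSqMemIff` — the statement of the Sketch, verbatim.
-/

set_option linter.dupNamespace false

noncomputable section

open MvPolynomial

namespace Summit.ResolutionOfSingularities.ResolutionOfSingularities.Theorems.EquisingularLift.Junction

section Helpers

variable {O : Type} [CommRing O]

/-- `C ϖ ∈ 𝔪`. [folklore] -/
theorem C_mem_junctionIdeal (ϖ : O) : (C ϖ : MvPolynomial (Fin 2) O) ∈ (Ideal.span {C ϖ, (X 0 : MvPolynomial (Fin 2) O), X 1} : Ideal (MvPolynomial (Fin 2) O)) :=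
  Ideal.subset_span (by simp)

/-- `X i ∈ 𝔪` for both variables. [folklore] -/
theorem X_mem_junctionIdeal (ϖ : O) (i : Fin 2) : (X i : MvPolynomial (Fin 2) O) ∈ (Ideal.span {C ϖ, (X 0 : MvPolynomial (Fin 2) O), X 1} : Ideal (MvPolynomial (Fin 2) O)) := by
  apply Ideal.subset_span
  fin_cases i <;> simp

/-- The image of `𝔪 = (ϖ, X₀, X₁)` under the constant-coefficient map is `(ϖ)`. [folklore] -/
theorem map_constantCoeff_junctionIdeal (ϖ : O) :
    ((Ideal.span {C ϖ, (X 0 : MvPolynomial (Fin 2) O), X 1} : Ideal (MvPolynomial (Fin 2) O))).map (constantCoeff : MvPolynomial (Fin 2) O →+* O) = Ideal.span {ϖ} := by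
  apply le_antisymm
  · rw [Ideal.map_le_iff_le_comap, Ideal.span_le]
    intro g hg
    simp only [Set.mem_insert_iff, Set.mem_singleton_iff] at hg
    rw [SetLike.mem_coe, Ideal.mem_comap]
    rcases hg with rfl | rfl | rfl
    · simp
    · simp
    · simp
  · rw [Ideal.span_le, Set.singleton_subset_iff, SetLike.mem_coe]
    have h := Ideal.mem_map_of_mem (constantCoeff : MvPolynomial (Fin 2) O →+* O) (C_mem_junctionIdeal ϖ)
    simp only [constantCoeff_C] at h
    exact h

/-- **Constant coefficients of elements of `𝔪ⁿ` lie in `(ϖⁿ)`.** [folklore] -/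
theorem constantCoeff_mem_span_pow_of_mem_pow (ϖ : O) {n : ℕ} {g : MvPolynomial (Fin 2) O}
    (hg : g ∈ (Ideal.span {C ϖ, (X 0 : MvPolynomial (Fin 2) O), X 1} : Ideal (MvPolynomial (Fin 2) O)) ^ n) : constantCoeff g ∈ Ideal.span {ϖ ^ n} := by
  have h := Ideal.mem_map_of_mem (constantCoeff : MvPolynomial (Fin 2) O →+* O) hg
  rwa [Ideal.map_pow, map_constantCoeff_junctionIdeal, Ideal.span_singleton_pow] at h

/-- **A polynomial minus its constant term lies in the ideal of the variables** `(X₀, X₁)`. [folklore] -/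
theorem sub_C_constantCoeff_mem_span_X (B : MvPolynomial (Fin 2) O) :
    B - C (constantCoeff B) ∈ Ideal.span (Set.range (X : Fin 2 → MvPolynomial (Fin 2) O)) := by
  rw [← Set.image_univ, MvPolynomial.mem_ideal_span_X_image]
  intro m hm
  have hm0 : m ≠ 0 := by
    rintro rfl
    rw [MvPolynomial.mem_support_iff] at hm
    apply hm
    rw [MvPolynomial.coeff_sub, MvPolynomial.coeff_zero_C]
    exact sub_eq_zero.mpr rfl
  obtain ⟨i, hi⟩ := Finsupp.ne_iff.mp hm0
  exact ⟨i, Set.mem_univ i, by simpa using hi⟩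

/-- `(X₀, X₁) ≤ 𝔪`. [folklore] -/
theorem span_X_le_junctionIdeal (ϖ : O) :
    Ideal.span (Set.range (X : Fin 2 → MvPolynomial (Fin 2) O)) ≤ (Ideal.span {C ϖ, (X 0 : MvPolynomial (Fin 2) O), X 1} : Ideal (MvPolynomial (Fin 2) O)) := by
  rw [Ideal.span_le]
  rintro _ ⟨i, rfl⟩
  exact X_mem_junctionIdeal ϖ i

end Helpers

/-- **Card 7 `junction-unscrewing`, step (a): the `𝔪²`-test at a junction** (res-L1-w45b-idea-2, Sketch-L1-idea-2.lean v5,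
VERBATIM). In `O[X₀, X₁]` with `𝔪 = (ϖ, X₀, X₁)`, `O` a domain, `ϖ ≠ 0`: the lifted node `X₀X₁ − ϖ·B` lies in `𝔪²` (the companion
centre is NOT regular at the junction) iff `B ∈ 𝔪` (`B` is not a unit at the junction). [`←`: `𝔪·𝔪 = 𝔪²`; `→`: constant
coefficients of elements of `𝔪²` lie in `(ϖ²)`, so `ϖ·B(0) ∈ (ϖ²)` forces `B(0) ∈ (ϖ)` in a domain, and `B − B(0) ∈ (X₀, X₁)`.]
OURS; AI-written. -/
theorem JunctionSqMemIff :
  ∀ (O : Type) [CommRing O] [IsDomain O] (ϖ : O), ϖ ≠ 0 → ∀ B : MvPolynomial (Fin 2) O,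
    (MvPolynomial.X 0 * MvPolynomial.X 1 - MvPolynomial.C ϖ * B ∈
        (Ideal.span {MvPolynomial.C ϖ, (MvPolynomial.X 0 : MvPolynomial (Fin 2) O), MvPolynomial.X 1}) ^ 2)
      ↔ B ∈ Ideal.span {MvPolynomial.C ϖ, (MvPolynomial.X 0 : MvPolynomial (Fin 2) O), MvPolynomial.X 1} := by
  intro O _ _ ϖ hϖ B
  set M : Ideal (MvPolynomial (Fin 2) O) :=
    Ideal.span {MvPolynomial.C ϖ, (MvPolynomial.X 0 : MvPolynomial (Fin 2) O), MvPolynomial.X 1} with hM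
  have hXX : (X 0 * X 1 : MvPolynomial (Fin 2) O) ∈ M ^ 2 := by
    rw [pow_two]
    exact Ideal.mul_mem_mul (X_mem_junctionIdeal ϖ 0) (X_mem_junctionIdeal ϖ 1)
  constructor
  · intro h
    -- `C ϖ * B ∈ 𝔪²`
    have hCB : C ϖ * B ∈ M ^ 2 := by
      have := Ideal.sub_mem _ hXX h
      rwa [sub_sub_cancel] at this
    -- constant coefficients: `ϖ * B(0) ∈ (ϖ²)`, hence `B(0) ∈ (ϖ)`
    have h0 : ϖ * constantCoeff B ∈ Ideal.span {ϖ ^ 2} := by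
      have := constantCoeff_mem_span_pow_of_mem_pow ϖ hCB
      simpa using this
    have h0' : constantCoeff B ∈ Ideal.span {ϖ} := by
      rw [Ideal.mem_span_singleton] at h0 ⊢
      rw [pow_two] at h0
      exact (mul_dvd_mul_iff_left hϖ).mp h0
    -- `B = C (B 0) + (B − C (B 0))`
    have h1 : C (constantCoeff B) ∈ M := by
      obtain ⟨c, hc⟩ := Ideal.mem_span_singleton'.mp h0'
      rw [← hc, map_mul]
      exact Ideal.mul_mem_left _ _ (C_mem_junctionIdeal ϖ)
    have h2 : B - C (constantCoeff B) ∈ M :=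
      span_X_le_junctionIdeal ϖ (sub_C_constantCoeff_mem_span_X B)
    have h3 := Ideal.add_mem _ h1 h2
    rwa [add_sub_cancel] at h3
  · intro hB
    have hCB : C ϖ * B ∈ M ^ 2 := by
      rw [pow_two]
      exact Ideal.mul_mem_mul (C_mem_junctionIdeal ϖ) hB
    exact Ideal.sub_mem _ hXX hCB

end Summit.ResolutionOfSingularities.ResolutionOfSingularities.Theorems.EquisingularLift.Junction

end
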